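import Literature.NumberTheory.PAdicHodge.BmaxPlusTheta
import Mathlib.RingTheory.Polynomial.Basic
import HarnessLib

/-!
# Normal form of `B⁰_max = 𝔸_inf[ξ/p]`, `ξ/p` is a non-zero-divisor on `A_max`, and `ker θ|_{A_max} = (ξ/p)·A_max`

Topic `Literature/NumberTheory/PAdicHodge`; namespace `Literature.NumberTheory.PAdicHodge`. THEOREMS ONLY (no definition, no named fact,
no instance). Continuation of `BmaxZero` / `BmaxPlus` / `BmaxPlusTheta` (Colmez's `A_max = B_max⁺(F)` = `p`-adic completion of
`B⁰_max = 𝔸_inf[ξ/p]`, `ω = ξ/p = omegaB`). Writing `𝔞 = (p, ξ) ⊆ 𝔸_inf`: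

* `mem_map_C_of_aeval_omegaB_eq_zero` — **normal form**: if `q(ξ/p) = 0` for `q ∈ 𝔸_inf[X]` then every coefficient of `q` lies in `𝔞`
  (the kernel of `𝔸_inf[X] → B⁰_max` is `(pX − ξ)`; induction on the degree, `ξ` being a non-zero-divisor mod `p`), and
  `mem_map_C_of_aeval_omegaB_mem_span` — `q(ξ/p) ∈ p·B⁰_max ⇒` all coefficients of `q` lie in `𝔞`; conversely
  `aeval_omegaB_mem_span_of_mem_map_C`. So `B⁰_max/p ≅ (𝔸_inf/𝔞)[T] = (𝒪_{ℂ_F}/p)[T]` is a polynomial ring.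
* `mem_span_pow_of_omegaB_mul_mem` — **`ξ/p` is a non-zero-divisor modulo every `pⁿ`**: `(ξ/p)·y ∈ pⁿB⁰_max ⇒ y ∈ pⁿB⁰_max`;
  hence ★ `eq_zero_of_omegaB_mul_eq_zero` — **`ξ/p` is a non-zero-divisor on `A_max`**.
* ★ `exists_eq_omegaB_mul_of_thetaBmaxPlus_eq_zero` / `thetaBmaxPlus_eq_zero_iff` — **`ker θ|_{A_max} = (ξ/p)·A_max`**
  (levelwise `ker θ|_{B⁰_max} = (ξ/p)B⁰_max` from `BmaxPlusTheta`, glued by the non-zero-divisor property).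

Brick B7 of the φ-road of line `kato_lever` (crux K★ `stmt-BirchSwinnertonDyer-22226`, memo
`Cruxes/StarredOptimalManinUnitFiveSeven/Lines/kato-lever-K2-phi-road.md`): first step `x = (ξ/p)·y` of Fontaine's lemma
`(A_max)^{φ=p} ∩ ker θ ⊆ ℚ_p·t`. Infrastructure only: BSD / K★ are not proved by any of this.

## References
* [Colmez1998Annals] P. Colmez, *Théorie d'Iwasawa des représentations de de Rham d'un corps local*, Ann. of Math. 148 (1998), §III.2.
* [BergerLaurent2002] L. Berger, *Représentations p-adiques et équations différentielles*, Invent. Math. 148 (2002), §1.2.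
* [FontaineAsterisque223III] J.-M. Fontaine, *Le corps des périodes p-adiques*, Astérisque 223 (1994), Exp. II §1.2, §2.3.
-/

noncomputable section

open WittVector Field ValuativeRel Polynomial Finset
open Literature.AlgebraicGeometry.Resolution

namespace Literature.NumberTheory.PAdicHodge

open Literature.NumberTheory.GaloisRepresentations
open Literature.NumberTheory.GaloisRepresentations.IsNonarchimedeanLocalField

variable {F : Type} [Field F] [ValuativeRel F] [TopologicalSpace F] [IsNonarchimedeanLocalField F]
  [CharZero F] {p : ℕ} [Fact p.Prime] [Fact (¬ IsUnit (p : integerC F))]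
  [IsAdicComplete (Ideal.span {(p : integerC F)}) (integerC F)]

/-! ### Every element of `B⁰_max` is a polynomial in `ξ/p` -/

omit [CharZero F] [IsAdicComplete (Ideal.span {(p : integerC F)}) (integerC F)] in
/-- `val (q(ξ/p)) = q(ξ/p)` computed in `𝔸_inf[1/p]`. [cite: BergerLaurent2002, §1.2] -/
theorem coe_aeval_omegaB (q : (Ainf (p := p) F)[X]) :
    ((aeval (omegaB : bmaxZero F p) q : bmaxZero F p) : Localization.Away (p : Ainf (p := p) F)) = aeval (xiDivP F p) q :=
  (Polynomial.aeval_algHom_apply (bmaxZero F p).val omegaB q).symm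

omit [CharZero F] [IsAdicComplete (Ideal.span {(p : integerC F)}) (integerC F)] in
/-- **Every `y ∈ B⁰_max = 𝔸_inf[ξ/p]` is `q(ξ/p)` for some `q ∈ 𝔸_inf[X]`.** [cite: BergerLaurent2002, §1.2] -/
theorem exists_aeval_omegaB_eq (y : bmaxZero F p) : ∃ q : (Ainf (p := p) F)[X], aeval (omegaB : bmaxZero F p) q = y := by
  have hy : (y : Localization.Away (p : Ainf (p := p) F)) ∈ (aeval (xiDivP F p) : (Ainf (p := p) F)[X] →ₐ[Ainf (p := p) F]
      Localization.Away (p : Ainf (p := p) F)).range := by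
    rw [← Algebra.adjoin_singleton_eq_range_aeval]; exact y.2
  obtain ⟨q, hq⟩ := hy
  exact ⟨q, Subtype.ext (by rw [coe_aeval_omegaB]; exact hq)⟩

/-! ### `𝔸_inf → B⁰_max` is injective; `p^N · q(ξ/p) ∈ 𝔸_inf` -/

/-- `𝔸_inf(F)` has characteristic zero. [folklore] -/
private theorem charZero_ainf' : CharZero (Ainf (p := p) F) := by
  haveI : CharZero (CompletedAlgClosure F) := charZero_of_injective_algebraMap (algebraMap F (CompletedAlgClosure F)).injective
  exact ((integerC F).subtype.comp (fontaineTheta (integerC F) p)).charZero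

/-- **`𝔸_inf → B⁰_max` is injective.** [cite: BergerLaurent2002, §1.2] -/
theorem algebraMap_bmaxZero_injective : Function.Injective (algebraMap (Ainf (p := p) F) (bmaxZero F p)) := by
  haveI := charZero_ainf' (F := F) (p := p)
  have hinj : Function.Injective (algebraMap (Ainf (p := p) F) (Localization.Away (p : Ainf (p := p) F))) :=
    IsLocalization.injective (Localization.Away (p : Ainf (p := p) F))
      (powers_le_nonZeroDivisors_of_noZeroDivisors (Nat.cast_ne_zero.2 (Fact.out : p.Prime).ne_zero))
  intro a b hab
  exact hinj (by rw [← coe_algebraMap_bmaxZero, ← coe_algebraMap_bmaxZero, hab])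

omit [CharZero F] [IsAdicComplete (Ideal.span {(p : integerC F)}) (integerC F)] in
/-- `p^j (ξ/p)^j = ξ^j` in `B⁰_max`. [folklore] -/
private theorem natCast_pow_mul_omegaB_pow (j : ℕ) :
    (p : bmaxZero F p) ^ j * omegaB ^ j = algebraMap (Ainf (p := p) F) (bmaxZero F p) (xi ^ j) := by
  rw [← mul_pow, natCast_mul_omegaB, map_pow]

omit [CharZero F] [IsAdicComplete (Ideal.span {(p : integerC F)}) (integerC F)] in
/-- **Clearing denominators**: `p^N · q(ξ/p) = Σ_j q_j p^{N−j} ξ^j ∈ 𝔸_inf` for `deg q ≤ N`. [cite: BergerLaurent2002, §1.2] -/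
theorem natCast_pow_mul_aeval_omegaB {q : (Ainf (p := p) F)[X]} {N : ℕ} (hN : q.natDegree ≤ N) :
    (p : bmaxZero F p) ^ N * aeval (omegaB : bmaxZero F p) q =
      algebraMap (Ainf (p := p) F) (bmaxZero F p) (∑ j ∈ range (N + 1), q.coeff j * (p : Ainf (p := p) F) ^ (N - j) * xi ^ j) := by
  rw [aeval_eq_sum_range' (Nat.lt_succ_of_le hN), mul_sum, map_sum]
  refine sum_congr rfl fun j hj => ?_
  have hjN : j ≤ N := Nat.le_of_lt_succ (mem_range.1 hj)
  have hpow : (p : bmaxZero F p) ^ N = (p : bmaxZero F p) ^ (N - j) * (p : bmaxZero F p) ^ j := by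
    rw [← pow_add, Nat.sub_add_cancel hjN]
  rw [Algebra.smul_def, map_mul, map_mul, map_pow, map_pow, map_natCast, ← natCast_mul_omegaB, hpow]
  ring

/-! ### Normal form: the kernel of `𝔸_inf[X] → B⁰_max`, `X ↦ ξ/p`, has coefficients in `𝔞 = (p, ξ)` -/

omit [CharZero F] [IsAdicComplete (Ideal.span {(p : integerC F)}) (integerC F)] in
/-- `(pX − ξ)·r` has all its coefficients in `𝔞 = (p, ξ)`: here for `r = c X^N`. [folklore] -/
private theorem relation_mem_map_C (c : Ainf (p := p) F) (N : ℕ) :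
    (C ((p : Ainf (p := p) F) * c) * X ^ (N + 1) - C (xi * c) * X ^ N : (Ainf (p := p) F)[X]) ∈
      (Ideal.span {(p : Ainf (p := p) F), xi}).map C := by
  refine Submodule.sub_mem _ (Ideal.mul_mem_right _ _ (Ideal.mem_map_of_mem C ?_)) (Ideal.mul_mem_right _ _ (Ideal.mem_map_of_mem C ?_))
  · exact Ideal.mul_mem_right _ _ (Ideal.subset_span (Set.mem_insert _ _))
  · exact Ideal.mul_mem_right _ _ (Ideal.subset_span (Set.mem_insert_of_mem _ (Set.mem_singleton _)))

omit [CharZero F] [IsAdicComplete (Ideal.span {(p : integerC F)}) (integerC F)] in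
/-- `(pX − ξ)·c X^N` vanishes at `ξ/p`. [folklore] -/
private theorem aeval_omegaB_relation (c : Ainf (p := p) F) (N : ℕ) :
    aeval (omegaB : bmaxZero F p) (C ((p : Ainf (p := p) F) * c) * X ^ (N + 1) - C (xi * c) * X ^ N) = 0 := by
  simp only [map_sub, map_mul, map_pow, aeval_C, aeval_X, map_natCast]
  rw [← natCast_mul_omegaB]; ring

/-- **Normal form of `B⁰_max = 𝔸_inf[ξ/p]`**: if `q(ξ/p) = 0` then every coefficient of `q ∈ 𝔸_inf[X]` lies in `𝔞 = (p, ξ)`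
(indeed `q ∈ (pX − ξ)𝔸_inf[X]`): clearing denominators, the top coefficient `q_N` satisfies `q_N ξ^N ∈ p𝔸_inf`, so `q_N ∈ p𝔸_inf`
(`ξ` is a non-zero-divisor mod `p`), and `q − (pX − ξ)(q_N/p)X^{N−1}` has smaller degree. [cite: Colmez1998Annals, §III.2] -/
theorem mem_map_C_of_aeval_omegaB_eq_zero :
    ∀ (N : ℕ) (q : (Ainf (p := p) F)[X]), q.natDegree ≤ N → aeval (omegaB : bmaxZero F p) q = 0 →
      q ∈ (Ideal.span {(p : Ainf (p := p) F), xi}).map C := by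
  intro N
  induction N with
  | zero =>
    intro q hq h0
    have hq0 : q = C (q.coeff 0) := Polynomial.eq_C_of_natDegree_le_zero hq
    rw [hq0, aeval_C] at h0
    have hc : q.coeff 0 = 0 := algebraMap_bmaxZero_injective (F := F) (p := p) (by rw [h0, map_zero])
    rw [hq0, hc, map_zero]
    exact Submodule.zero_mem _
  | succ N ih =>
    intro q hq h0
    -- clearing denominators: `Σ_{j ≤ N+1} q_j p^{N+1-j} ξ^j = 0`
    have h1 : ∑ j ∈ range (N + 1 + 1), q.coeff j * (p : Ainf (p := p) F) ^ (N + 1 - j) * xi ^ j = 0 :=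
      algebraMap_bmaxZero_injective (by rw [← natCast_pow_mul_aeval_omegaB hq, h0, mul_zero, map_zero])
    -- the top coefficient is divisible by `p`
    have h2 : xi ^ (N + 1) * q.coeff (N + 1) ∈ Ideal.span {(p : Ainf (p := p) F) ^ 1} := by
      rw [sum_range_succ, Nat.sub_self, pow_zero, mul_one] at h1
      rw [pow_one, Ideal.mem_span_singleton']
      refine ⟨-(∑ j ∈ range (N + 1), q.coeff j * (p : Ainf (p := p) F) ^ (N - j) * xi ^ j), ?_⟩
      rw [mul_comm (xi ^ (N + 1)), eq_neg_of_add_eq_zero_right h1, neg_mul, neg_inj, sum_mul]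
      refine sum_congr rfl fun j hj => ?_
      have hjN : j ≤ N := Nat.le_of_lt_succ (mem_range.1 hj)
      rw [show N + 1 - j = N - j + 1 by omega, pow_succ]; ring
    have h3 := mem_span_p_pow_of_xi_pow_mul_mem (N + 1) 1 h2
    rw [pow_one, Ideal.mem_span_singleton'] at h3
    obtain ⟨c, hc⟩ := h3
    -- subtract the relation `(pX − ξ)·c X^N`
    set r : (Ainf (p := p) F)[X] := C ((p : Ainf (p := p) F) * c) * X ^ (N + 1) - C (xi * c) * X ^ N with hr
    have hq' : (q - r).natDegree ≤ N := by
      rw [Polynomial.natDegree_le_iff_coeff_eq_zero]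
      intro M hM
      rw [coeff_sub, hr, coeff_sub, coeff_C_mul_X_pow, coeff_C_mul_X_pow]
      rcases Nat.lt_or_ge (N + 1) M with hM' | hM'
      · rw [if_neg (by omega), if_neg (by omega), sub_zero, sub_zero]
        exact Polynomial.coeff_eq_zero_of_natDegree_lt (lt_of_le_of_lt hq hM')
      · have hMeq : M = N + 1 := le_antisymm hM' hM
        subst hMeq
        rw [if_pos rfl, if_neg (by omega), sub_zero, ← hc, mul_comm, sub_self]
    have h0' : aeval (omegaB : bmaxZero F p) (q - r) = 0 := by rw [map_sub, h0, hr, aeval_omegaB_relation, sub_zero]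
    have h4 := ih (q - r) hq' h0'
    have h5 : q = (q - r) + r := (sub_add_cancel q r).symm
    rw [h5]
    exact Submodule.add_mem _ h4 (relation_mem_map_C c N)

/-- **`q(ξ/p) ∈ p·B⁰_max ⇒` every coefficient of `q` lies in `𝔞 = (p, ξ)`.** [cite: Colmez1998Annals, §III.2] -/
theorem mem_map_C_of_aeval_omegaB_mem_span {q : (Ainf (p := p) F)[X]}
    (hq : aeval (omegaB : bmaxZero F p) q ∈ Ideal.span {(p : bmaxZero F p)}) :
    q ∈ (Ideal.span {(p : Ainf (p := p) F), xi}).map C := by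
  rw [Ideal.mem_span_singleton'] at hq
  obtain ⟨z, hz⟩ := hq
  obtain ⟨r, rfl⟩ := exists_aeval_omegaB_eq z
  have h0 : aeval (omegaB : bmaxZero F p) (q - C (p : Ainf (p := p) F) * r) = 0 := by
    rw [map_sub, map_mul, aeval_C, map_natCast, ← hz, mul_comm, sub_self]
  have h1 := mem_map_C_of_aeval_omegaB_eq_zero _ _ le_rfl h0
  have h2 : C (p : Ainf (p := p) F) * r ∈ (Ideal.span {(p : Ainf (p := p) F), xi}).map C :=
    Ideal.mul_mem_right _ _ (Ideal.mem_map_of_mem C (Ideal.subset_span (Set.mem_insert _ _)))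
  have h3 : q = (q - C (p : Ainf (p := p) F) * r) + C (p : Ainf (p := p) F) * r := (sub_add_cancel _ _).symm
  rw [h3]
  exact Submodule.add_mem _ h1 h2

omit [CharZero F] [IsAdicComplete (Ideal.span {(p : integerC F)}) (integerC F)] in
/-- **Conversely, `q(ξ/p) ∈ p·B⁰_max` if all coefficients of `q` lie in `𝔞`** (`𝔞 ↦ p·B⁰_max`). [cite: Colmez1998Annals, §III.2] -/
theorem aeval_omegaB_mem_span_of_mem_map_C {q : (Ainf (p := p) F)[X]} (hq : q ∈ (Ideal.span {(p : Ainf (p := p) F), xi}).map C) :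
    aeval (omegaB : bmaxZero F p) q ∈ Ideal.span {(p : bmaxZero F p)} := by
  rw [Ideal.mem_map_C_iff] at hq
  rw [aeval_eq_sum_range]
  refine Ideal.sum_mem _ fun j _ => ?_
  rw [Algebra.smul_def]
  exact Ideal.mul_mem_right _ _ (algebraMap_mem_span_of_mem_span_p_xi (hq j))

/-- **`B⁰_max/p` as a polynomial ring**: `q(ξ/p) ∈ p·B⁰_max ↔` all coefficients of `q` lie in `(p, ξ)`. [cite: Colmez1998Annals, §III.2] -/
theorem aeval_omegaB_mem_span_iff (q : (Ainf (p := p) F)[X]) :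
    aeval (omegaB : bmaxZero F p) q ∈ Ideal.span {(p : bmaxZero F p)} ↔ q ∈ (Ideal.span {(p : Ainf (p := p) F), xi}).map C :=
  ⟨mem_map_C_of_aeval_omegaB_mem_span, aeval_omegaB_mem_span_of_mem_map_C⟩

/-! ### `ξ/p` is a non-zero-divisor modulo `pⁿ` and on `A_max` -/

/-- **`(ξ/p)·y ∈ p·B⁰_max ⇒ y ∈ p·B⁰_max`** (`ξ/p` is a non-zero-divisor on the polynomial ring `B⁰_max/p`).
[cite: Colmez1998Annals, §III.2] -/
theorem mem_span_of_omegaB_mul_mem {y : bmaxZero F p} (hy : omegaB * y ∈ Ideal.span {(p : bmaxZero F p)}) :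
    y ∈ Ideal.span {(p : bmaxZero F p)} := by
  obtain ⟨q, rfl⟩ := exists_aeval_omegaB_eq y
  have h1 : aeval (omegaB : bmaxZero F p) (X * q) ∈ Ideal.span {(p : bmaxZero F p)} := by rwa [map_mul, aeval_X]
  have h2 := mem_map_C_of_aeval_omegaB_mem_span h1
  refine aeval_omegaB_mem_span_of_mem_map_C ?_
  rw [Ideal.mem_map_C_iff] at h2 ⊢
  intro j
  have := h2 (j + 1)
  rwa [coeff_X_mul] at this

/-- **`(ξ/p)·y ∈ pⁿ·B⁰_max ⇒ y ∈ pⁿ·B⁰_max`.** [cite: Colmez1998Annals, §III.2] -/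
theorem mem_span_pow_of_omegaB_mul_mem (n : ℕ) :
    ∀ {y : bmaxZero F p}, omegaB * y ∈ Ideal.span {(p : bmaxZero F p)} ^ n → y ∈ Ideal.span {(p : bmaxZero F p)} ^ n := by
  induction n with
  | zero => intro y _; rw [pow_zero, Ideal.one_eq_top]; exact Submodule.mem_top
  | succ n ih =>
    intro y hy
    have hy1 : omegaB * y ∈ Ideal.span {(p : bmaxZero F p)} :=
      Ideal.pow_le_self (I := Ideal.span {(p : bmaxZero F p)}) (Nat.succ_ne_zero n) hy
    have hy2 := mem_span_of_omegaB_mul_mem hy1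
    rw [Ideal.mem_span_singleton'] at hy2
    obtain ⟨y', rfl⟩ := hy2
    have hy3 := hy
    rw [Ideal.span_singleton_pow, Ideal.mem_span_singleton'] at hy3
    obtain ⟨w, hw⟩ := hy3
    have h4 : omegaB * y' ∈ Ideal.span {(p : bmaxZero F p)} ^ n := by
      rw [Ideal.span_singleton_pow, Ideal.mem_span_singleton']
      refine ⟨w, eq_of_natCast_pow_mul_eq (p := p) (F := F) (v := 1) ?_⟩
      rw [pow_one]
      linear_combination hw
    have h5 := ih h4
    rw [Ideal.span_singleton_pow, Ideal.mem_span_singleton'] at h5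
    obtain ⟨w', hw'⟩ := h5
    rw [Ideal.span_singleton_pow, Ideal.mem_span_singleton']
    exact ⟨w', by rw [pow_succ, ← mul_assoc, hw']⟩

set_option maxHeartbeats 1600000 in
/-- ★ **`ξ/p` is a non-zero-divisor on `A_max = B_max⁺(F)`**: `(ξ/p)·z = 0 ⇒ z = 0` (levelwise). [cite: Colmez1998Annals, §III.2] -/
theorem eq_zero_of_omegaB_mul_eq_zero {z : BmaxPlus F p}
    (hz : algebraMap (bmaxZero F p) (BmaxPlus F p) omegaB * z = 0) : z = 0 := by
  refine AdicCompletion.ext_evalₐ fun n => ?_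
  obtain ⟨y, hy⟩ := Ideal.Quotient.mk_surjective (AdicCompletion.evalₐ (Ideal.span {(p : bmaxZero F p)}) n z)
  have h1 : AdicCompletion.evalₐ (Ideal.span {(p : bmaxZero F p)}) n (algebraMap (bmaxZero F p) (BmaxPlus F p) omegaB) =
      Ideal.Quotient.mk (Ideal.span {(p : bmaxZero F p)} ^ n) omegaB := AdicCompletion.evalₐ_of _ n _
  have h2 : Ideal.Quotient.mk (Ideal.span {(p : bmaxZero F p)} ^ n) (omegaB * y) = 0 := by
    rw [map_mul, hy, ← h1, ← map_mul, hz, map_zero]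
  have h3 : omegaB * y ∈ Ideal.span {(p : bmaxZero F p)} ^ n := Ideal.Quotient.eq_zero_iff_mem.1 h2
  rw [map_zero, ← hy]
  exact Ideal.Quotient.eq_zero_iff_mem.2 (mem_span_pow_of_omegaB_mul_mem n h3)

/-! ### `ker θ|_{A_max} = (ξ/p)·A_max` -/

/-- On `B⁰_max`: if `θ(x₀) ∈ pⁿ𝒪_{ℂ_F}` then `x₀ = (ξ/p)·y + pⁿ·a` for some `y ∈ B⁰_max`, `a ∈ 𝔸_inf` (`θ` is onto, `ker θ|_{B⁰_max} = (ξ/p)`).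
[cite: Colmez1998Annals, §III.2] -/
theorem exists_eq_omegaB_mul_add_of_thetaBmaxZero_mem (hF : Function.Surjective (fontaineTheta (integerC F) p)) {n : ℕ}
    {x₀ : bmaxZero F p} (h : thetaBmaxZero F p x₀ ∈ Ideal.span {(p : integerC F)} ^ n) :
    ∃ (y : bmaxZero F p) (a : Ainf (p := p) F), x₀ = omegaB * y + (p : bmaxZero F p) ^ n * algebraMap (Ainf (p := p) F) (bmaxZero F p) a := by
  rw [Ideal.span_singleton_pow, Ideal.mem_span_singleton'] at h
  obtain ⟨c, hc⟩ := h
  obtain ⟨a, ha⟩ := hF c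
  have h2 : thetaBmaxZero F p (x₀ - (p : bmaxZero F p) ^ n * algebraMap (Ainf (p := p) F) (bmaxZero F p) a) = 0 := by
    rw [map_sub, map_mul, map_pow, thetaBmaxZero_natCast, thetaBmaxZero_algebraMap, ha, ← hc, mul_comm c, sub_self]
  rw [thetaBmaxZero_eq_zero_iff] at h2
  obtain ⟨y, hy⟩ := h2
  exact ⟨y, a, by rw [← hy, sub_add_cancel]⟩

set_option maxHeartbeats 1600000 in
/-- Level representatives of an element of `ker θ|_{A_max}` may be taken in `(ξ/p)·B⁰_max`: if `θ(x) = 0` then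
`x ≡ (ξ/p)·y (mod pⁿ)` for some `y ∈ B⁰_max`. [cite: Colmez1998Annals, §III.2] -/
theorem exists_evalₐ_eq_mk_omegaB_mul (hF : Function.Surjective (fontaineTheta (integerC F) p)) {x : BmaxPlus F p}
    (hx : thetaBmaxPlus F p x = 0) (n : ℕ) :
    ∃ y : bmaxZero F p, AdicCompletion.evalₐ (Ideal.span {(p : bmaxZero F p)}) n x = Ideal.Quotient.mk _ (omegaB * y) := by
  obtain ⟨x₀, hx₀⟩ := Ideal.Quotient.mk_surjective (AdicCompletion.evalₐ (Ideal.span {(p : bmaxZero F p)}) n x)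
  have h1 := thetaBmaxPlus_sub_mem_of_evalₐ_eq hx₀.symm
  rw [hx, zero_sub, Ideal.neg_mem_iff] at h1
  obtain ⟨y, a, hya⟩ := exists_eq_omegaB_mul_add_of_thetaBmaxZero_mem hF h1
  have h2 : x₀ - omegaB * y ∈ Ideal.span {(p : bmaxZero F p)} ^ n := by
    rw [hya, add_sub_cancel_left, Ideal.span_singleton_pow]
    exact Ideal.mul_mem_right _ _ (Ideal.mem_span_singleton_self _)
  exact ⟨y, hx₀.symm.trans ((Ideal.Quotient.eq).2 h2)⟩

set_option maxHeartbeats 1600000 in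
/-- ★ **`ker θ|_{A_max} = (ξ/p)·A_max`**: if `θ(x) = 0` for `x ∈ A_max = B_max⁺(F)` then `x = (ξ/p)·y` for some `y ∈ A_max`
(the levelwise quotients `yₙ` are compatible because `ξ/p` is a non-zero-divisor mod `pⁿ`, and converge `p`-adically).
[cite: Colmez1998Annals, §III.2] -/
theorem exists_eq_omegaB_mul_of_thetaBmaxPlus_eq_zero (hF : Function.Surjective (fontaineTheta (integerC F) p))
    {x : BmaxPlus F p} (hx : thetaBmaxPlus F p x = 0) :
    ∃ y : BmaxPlus F p, x = algebraMap (bmaxZero F p) (BmaxPlus F p) omegaB * y := by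
  choose y hy using exists_evalₐ_eq_mk_omegaB_mul hF hx
  -- the `yₙ` are compatible
  have hcauchy : AdicCompletion.IsAdicCauchy (Ideal.span {(p : bmaxZero F p)}) (bmaxZero F p) y := by
    intro m n hmn
    rw [SModEq.sub_mem, smul_eq_mul, Ideal.mul_top]
    have h := factorPow_evalₐ (Ideal.span {(p : bmaxZero F p)}) hmn x
    have e : Ideal.Quotient.mk (Ideal.span {(p : bmaxZero F p)} ^ m) (omegaB * y n) =
        Ideal.Quotient.mk (Ideal.span {(p : bmaxZero F p)} ^ m) (omegaB * y m) :=
      calc Ideal.Quotient.mk (Ideal.span {(p : bmaxZero F p)} ^ m) (omegaB * y n)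
          = Ideal.Quotient.factorPow (Ideal.span {(p : bmaxZero F p)}) hmn
              (Ideal.Quotient.mk (Ideal.span {(p : bmaxZero F p)} ^ n) (omegaB * y n)) := (Ideal.Quotient.factor_mk _ _).symm
        _ = Ideal.Quotient.factorPow (Ideal.span {(p : bmaxZero F p)}) hmn
              (AdicCompletion.evalₐ (Ideal.span {(p : bmaxZero F p)}) n x) := congrArg _ (hy n).symm
        _ = AdicCompletion.evalₐ (Ideal.span {(p : bmaxZero F p)}) m x := h
        _ = Ideal.Quotient.mk (Ideal.span {(p : bmaxZero F p)} ^ m) (omegaB * y m) := hy m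
    have h2 : omegaB * (y m - y n) ∈ Ideal.span {(p : bmaxZero F p)} ^ m := by
      rw [mul_sub, ← Ideal.neg_mem_iff, neg_sub]; exact (Ideal.Quotient.eq).1 e
    exact mem_span_pow_of_omegaB_mul_mem m h2
  refine ⟨AdicCompletion.mk (Ideal.span {(p : bmaxZero F p)}) (bmaxZero F p) ⟨y, hcauchy⟩, AdicCompletion.ext_evalₐ fun n => ?_⟩
  have h1 : AdicCompletion.evalₐ (Ideal.span {(p : bmaxZero F p)}) n (algebraMap (bmaxZero F p) (BmaxPlus F p) omegaB) =
      Ideal.Quotient.mk (Ideal.span {(p : bmaxZero F p)} ^ n) omegaB := AdicCompletion.evalₐ_of _ n _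
  have e1 : AdicCompletion.evalₐ (Ideal.span {(p : bmaxZero F p)}) n
      (AdicCompletion.mk (Ideal.span {(p : bmaxZero F p)}) (bmaxZero F p) ⟨y, hcauchy⟩) =
      Ideal.Quotient.mk (Ideal.span {(p : bmaxZero F p)} ^ n) (y n) := AdicCompletion.evalₐ_mk _ _ _
  have e2 : AdicCompletion.evalₐ (Ideal.span {(p : bmaxZero F p)}) n (algebraMap (bmaxZero F p) (BmaxPlus F p) omegaB *
      AdicCompletion.mk (Ideal.span {(p : bmaxZero F p)}) (bmaxZero F p) ⟨y, hcauchy⟩) =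
      Ideal.Quotient.mk (Ideal.span {(p : bmaxZero F p)} ^ n) (omegaB * y n) := by
    rw [map_mul, h1, e1, ← map_mul]
  exact (hy n).trans e2.symm

/-- **`ker θ|_{A_max} = (ξ/p)·A_max`, iff form.** [cite: Colmez1998Annals, §III.2] -/
theorem thetaBmaxPlus_eq_zero_iff (hF : Function.Surjective (fontaineTheta (integerC F) p)) (x : BmaxPlus F p) :
    thetaBmaxPlus F p x = 0 ↔ ∃ y : BmaxPlus F p, x = algebraMap (bmaxZero F p) (BmaxPlus F p) omegaB * y := by
  refine ⟨exists_eq_omegaB_mul_of_thetaBmaxPlus_eq_zero hF, ?_⟩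
  rintro ⟨y, rfl⟩
  rw [map_mul, thetaBmaxPlus_algebraMap, thetaBmaxZero_omegaB, zero_mul]

end Literature.NumberTheory.PAdicHodge

end
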